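import Summits.CriticalPhenomena.CardyFormulaZ2.Theorems.CardyComplexConeEdgePrecompactUFRSTwoArcGlue
import Summits.CriticalPhenomena.CardyFormulaZ2.Theorems.CardyComplexConeEdgePrecompactUFRSTwoArcExcursion

set_option linter.unusedVariables false

/-!
# Two orbit stretches leaving and re-entering a ball with different turning: a far-reaching excursion polygon
(line `qkz-strip-boundary-arm` of crux `CardyComplexCone.EdgePrecompact`, stmt-CriticalPhenomena-11387;
the planar input of the BALL-EXIT case of the residual `ufrs_slippedReturnCase_cert(J)`, registered
as `medialTwoArcSurround_ball`)

`medialTwoArcSurround_ball`: two injective orbit stretches `O₀ c [0, n₀]` (dynamics `β₀`) and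
`O₁ c [0, n₁]` (dynamics `β₁`) from the same corner `c` with the same last corner and different
turning sums `∑ turnOf`, such that the start point `medialPoint δ (cSrc c)` and the end point
`medialPoint δ (cTgt (O₀ c n₀))` lie in a ball `B(δ v, r)` which contains no other target midpoint of
either stretch. Then some EXCURSION of the second stretch relative to the first (a maximal free
sub-stretch between consecutive common corners, not a common step) closes up with the piece of the
first stretch between its end corners into a polygon that is FAR-REACHING with respect to the start
point `A`: for every `q₀ ∈ ℂ` it has a vertex `q` with `dist A q₀ ≤ dist q q₀ + δ`. This is the
statement `medialTwoArcSurround` proposed by the residual's analysis, under the extra ball hypotheses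
(which are those of the ball-exit pair of the residual); the general case needs a Jordan theorem for
cusp-free bigon polygons that the tree does not have.

Proof: the medial similarity `psiC δ` (`medialPoint δ (cSrc p) = psiC δ (cpos p)`, ratio `δ/√2`)
turns the ball hypotheses into the potential hypotheses of `twoArc_dartWnd_ne_SR` (the two coded arcs
are closed by one dart path inside the ball; closable open-arc Umlaufsatz); `exists_excursion_quadrants_SR`
gives an excursion polygon with a vertex in every lattice quadrant at a face of the first dart, and a
vertex in the right quadrant is at least as far from `q₀` as `A`, up to `δ`.

References: H. Hopf, Compositio Math. 2 (1935), Satz I; S. Smirnov, C. R. Acad. Sci. Paris 333 (2001), §2.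
-/

namespace Summit.CriticalPhenomena.CardyFormulaZ2.Cruxes.EdgePrecompact.QkzStripBoundaryArm

open MeasureTheory Filter Set Metric
open scoped Topology BigOperators Pointwise
open Literature.Probability.LatticeModels Literature.Probability.Percolation
open Literature.Probability.LatticeModels.MedialTrail

noncomputable section

/-! ## The medial similarity -/

/-- The similarity of ratio `δ/√2` taking medial coordinates to the plane: `(x, y) ↦ δ((x-y+1) + (x+y) i)/2`. -/
def psiC (δ : ℝ) (P : MedialTrail.Pt) : ℂ := (δ / 2 : ℂ) * (((P.1 - P.2 + 1 : ℤ) : ℂ) + ((P.1 + P.2 : ℤ) : ℂ) * Complex.I)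

/-- Real part of `psiC`. -/
theorem psiC_re (δ : ℝ) (P : Pt) : (psiC δ P).re = δ / 2 * (P.1 - P.2 + 1 : ℤ) := by
  simp [psiC]

/-- Imaginary part of `psiC`. -/
theorem psiC_im (δ : ℝ) (P : Pt) : (psiC δ P).im = δ / 2 * (P.1 + P.2 : ℤ) := by
  simp [psiC]

/-- **The coded corner sits at the midpoint of its source edge**: `medialPoint δ (cSrc p) = psiC δ (cpos p)`. -/
theorem medialPoint_cSrc_eq_psiC_SR (δ : ℝ) (p : Site 2 × Fin 4) : medialPoint δ (cSrc p) = psiC δ (cpos p) := by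
  obtain ⟨v, k⟩ := p
  rw [medialPoint_cSrc]
  apply Complex.ext
  · rw [psiC_re]
    fin_cases k <;> simp [cpos, cposOff] <;> ring
  · rw [psiC_im]
    fin_cases k <;> simp [cpos, cposOff] <;> ring

/-- The target midpoint of an orbit corner is the coded point of the next corner. -/
theorem medialPoint_cTgt_cornerOrbit_SR (δ : ℝ) (β : BondConfig (Site 2)) (c : Site 2 × Fin 4) (i : ℕ) :
    medialPoint δ (cTgt (cornerOrbit β c i)) = psiC δ (cpos (cornerOrbit β c (i + 1))) := by
  rw [← medialPoint_cSrc_eq_psiC_SR]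
  change medialPoint δ (cTgt (cornerOrbit β c i)) = medialPoint δ (cSrc (nextCorner β (cornerOrbit β c i)))
  rw [cSrc_nextCorner]

/-- **Distances to a lattice site in medial coordinates**: `dist (psiC δ P) (δ v)² = δ²/8 · pot`, with
the integer potential `pot = (2x - a)² + (2y - b)²`, `a = 2(v₀ + v₁) - 1`, `b = 2(v₁ - v₀) + 1`. -/
theorem dist_psiC_sq_SR (δ : ℝ) (P : Pt) (v : Site 2) :
    dist (psiC δ P) (meshPoint δ v) ^ 2 =
      δ ^ 2 / 8 * (((2 * P.1 - (2 * (v 0 + v 1) - 1)) ^ 2 + (2 * P.2 - (2 * (v 1 - v 0) + 1)) ^ 2 : ℤ) : ℝ) := by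
  rw [dist_eq_norm, Complex.sq_norm, Complex.normSq_apply, Complex.sub_re, Complex.sub_im, psiC_re, psiC_im,
    meshPoint_re, meshPoint_im]
  push_cast
  ring

/-- Inside/outside the ball compares potentials. -/
theorem pot_lt_of_ball_SR {δ : ℝ} (hδ : 0 < δ) {P Q : Pt} {v : Site 2} {r : ℝ}
    (hP : psiC δ P ∈ ball (meshPoint δ v) r) (hQ : psiC δ Q ∉ ball (meshPoint δ v) r) :
    (2 * P.1 - (2 * (v 0 + v 1) - 1)) ^ 2 + (2 * P.2 - (2 * (v 1 - v 0) + 1)) ^ 2 <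
      (2 * Q.1 - (2 * (v 0 + v 1) - 1)) ^ 2 + (2 * Q.2 - (2 * (v 1 - v 0) + 1)) ^ 2 := by
  rw [mem_ball] at hP hQ
  push Not at hQ
  have h1 := dist_psiC_sq_SR δ P v
  have h2 := dist_psiC_sq_SR δ Q v
  have hd : 0 ≤ dist (psiC δ P) (meshPoint δ v) := dist_nonneg
  have hlt : dist (psiC δ P) (meshPoint δ v) ^ 2 < dist (psiC δ Q) (meshPoint δ v) ^ 2 := by
    nlinarith
  rw [h1, h2] at hlt
  have hδ2 : 0 < δ ^ 2 / 8 := by positivity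
  exact_mod_cast lt_of_mul_lt_mul_left hlt hδ2.le

/-! ## From lattice quadrants to far-reaching -/

/-- The plane point of the centre of the medial face `F`. -/
def faceCentreC (δ : ℝ) (F : MedialTrail.Pt) : ℂ := (δ / 2 : ℂ) * (((F.1 - F.2 + 1 : ℤ) : ℂ) + ((F.1 + F.2 + 1 : ℤ) : ℂ) * Complex.I)

/-- The real inner product of two complex numbers, written out. -/
theorem re_im_le_norm_mul_SR (z w : ℂ) : z.re * w.re + z.im * w.im ≤ ‖z‖ * ‖w‖ := by
  have h : z.re * w.re + z.im * w.im = (z * (starRingEnd ℂ) w).re := by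
    simp [Complex.mul_re]
  rw [h, ← Complex.norm_conj w, ← norm_mul]
  exact Complex.re_le_norm _

/-- **A vertex in the right quadrant is far.** If `z = q - f` lies in the closed cone `{⟨z, u⟩ ≥ 0}`
of the direction `u = A - q₀`, and `‖f - A‖ ≤ δ`, then `dist A q₀ ≤ dist q q₀ + δ`. -/
theorem dist_le_of_inner_nonneg_SR {A q₀ q f : ℂ} {δ : ℝ}
    (hcone : 0 ≤ (q - f).re * (A - q₀).re + (q - f).im * (A - q₀).im) (hf : ‖f - A‖ ≤ δ) :
    dist A q₀ ≤ dist q q₀ + δ := by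
  rw [dist_eq_norm, dist_eq_norm]
  have hsq : ‖A - q₀‖ ^ 2 = (A - q₀).re * (A - q₀).re + (A - q₀).im * (A - q₀).im := by
    rw [Complex.sq_norm, Complex.normSq_apply]
  have h1 := re_im_le_norm_mul_SR (A - f) (A - q₀)
  have h2 := re_im_le_norm_mul_SR (q - q₀) (A - q₀)
  have hAf : ‖A - f‖ ≤ δ := by rw [← norm_neg, neg_sub]; exact hf
  have hu0 : 0 ≤ ‖A - q₀‖ := norm_nonneg _
  have er : (A - q₀).re = (A - f).re - (q - f).re + (q - q₀).re := by simp only [Complex.sub_re]; ring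
  have ei : (A - q₀).im = (A - f).im - (q - f).im + (q - q₀).im := by simp only [Complex.sub_im]; ring
  have key : ‖A - q₀‖ ^ 2 ≤ (‖A - f‖ + ‖q - q₀‖) * ‖A - q₀‖ := by
    have e : (A - q₀).re * (A - q₀).re + (A - q₀).im * (A - q₀).im =
        ((A - f).re - (q - f).re + (q - q₀).re) * (A - q₀).re +
          ((A - f).im - (q - f).im + (q - q₀).im) * (A - q₀).im := by rw [← er, ← ei]
    rw [hsq, e]; nlinarith
  by_cases h0 : ‖A - q₀‖ = 0
  · rw [h0]; linarith [norm_nonneg (q - q₀), norm_nonneg (f - A)]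
  · have hpos : 0 < ‖A - q₀‖ := lt_of_le_of_ne hu0 (Ne.symm h0)
    have : ‖A - q₀‖ ≤ ‖A - f‖ + ‖q - q₀‖ := by
      by_contra hc; push Not at hc; nlinarith
    linarith

/-- The centre of a face adjacent to the tail of a step is within `δ` of the tail. -/
theorem norm_faceCentre_sub_le_SR {δ : ℝ} (hδ : 0 < δ) (F P : Pt)
    (hF : (F.1 = P.1 ∨ F.1 = P.1 - 1) ∧ (F.2 = P.2 ∨ F.2 = P.2 - 1)) : ‖faceCentreC δ F - psiC δ P‖ ≤ δ := by
  refine (Complex.norm_le_abs_re_add_abs_im _).trans ?_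
  have hre : (faceCentreC δ F - psiC δ P).re = δ / 2 * ((F.1 - P.1 : ℤ) - (F.2 - P.2 : ℤ)) := by
    rw [Complex.sub_re, psiC_re]; simp [faceCentreC]; ring
  have him : (faceCentreC δ F - psiC δ P).im = δ / 2 * ((F.1 - P.1 : ℤ) + (F.2 - P.2 : ℤ) + 1) := by
    rw [Complex.sub_im, psiC_im]; simp [faceCentreC]; ring
  have i1 : -1 ≤ (F.1 - P.1) - (F.2 - P.2) ∧ (F.1 - P.1) - (F.2 - P.2) ≤ 1 := by omega
  have i2 : -1 ≤ (F.1 - P.1) + (F.2 - P.2) + 1 ∧ (F.1 - P.1) + (F.2 - P.2) + 1 ≤ 1 := by omega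
  have r1 : |((F.1 - P.1 : ℤ) : ℝ) - ((F.2 - P.2 : ℤ) : ℝ)| ≤ 1 := by
    rw [abs_le]; constructor <;> exact_mod_cast (by omega : _)
  have r2 : |((F.1 - P.1 : ℤ) : ℝ) + ((F.2 - P.2 : ℤ) : ℝ) + 1| ≤ 1 := by
    rw [abs_le]; constructor <;> exact_mod_cast (by omega : _)
  have hδ2 : 0 < δ / 2 := by positivity
  rw [hre, him, abs_mul, abs_mul, abs_of_pos hδ2]
  nlinarith

/-- The two faces of a step are adjacent to its tail. -/
theorem faces_adjacent_tail_SR (d : Pt × Pt) :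
    (((lf d).1 = d.1.1 ∨ (lf d).1 = d.1.1 - 1) ∧ ((lf d).2 = d.1.2 ∨ (lf d).2 = d.1.2 - 1)) ∧
      (((rf d).1 = d.1.1 ∨ (rf d).1 = d.1.1 - 1) ∧ ((rf d).2 = d.1.2 ∨ (rf d).2 = d.1.2 - 1)) := by
  simp only [lf, rf]
  split_ifs <;> simp

/-- **Quadrant vertices make the polygon far-reaching.** If a point set `S ⊆ ℤ²` meets each of the
four closed lattice quadrants at the face `F`, and `F` is adjacent to the point `P₀`, then for every
`q₀ ∈ ℂ` some `p ∈ S` satisfies `dist (psiC δ P₀) q₀ ≤ dist (psiC δ p) q₀ + δ`. -/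
theorem farReach_of_quadrants_SR {δ : ℝ} (hδ : 0 < δ) (F P₀ : Pt) (S : Set Pt)
    (hF : (F.1 = P₀.1 ∨ F.1 = P₀.1 - 1) ∧ (F.2 = P₀.2 ∨ F.2 = P₀.2 - 1))
    (hNE : ∃ p ∈ S, F.1 + 1 ≤ p.1 ∧ F.2 + 1 ≤ p.2) (hNW : ∃ p ∈ S, p.1 ≤ F.1 ∧ F.2 + 1 ≤ p.2)
    (hSW : ∃ p ∈ S, p.1 ≤ F.1 ∧ p.2 ≤ F.2) (hSE : ∃ p ∈ S, F.1 + 1 ≤ p.1 ∧ p.2 ≤ F.2) (q₀ : ℂ) :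
    ∃ p ∈ S, dist (psiC δ P₀) q₀ ≤ dist (psiC δ p) q₀ + δ := by
  have hf := norm_faceCentre_sub_le_SR hδ F P₀ hF
  set u := psiC δ P₀ - q₀ with hu
  -- components of `psiC δ p - faceCentreC δ F`
  have hre : ∀ p : Pt, (psiC δ p - faceCentreC δ F).re = δ / 2 * ((p.1 - F.1 : ℤ) - (p.2 - F.2 : ℤ)) := by
    intro p; rw [Complex.sub_re, psiC_re]; simp [faceCentreC]; ring
  have him : ∀ p : Pt, (psiC δ p - faceCentreC δ F).im = δ / 2 * ((p.1 - F.1 : ℤ) + (p.2 - F.2 : ℤ) - 1) := by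
    intro p; rw [Complex.sub_im, psiC_im]; simp [faceCentreC]; ring
  have hδ2 : 0 < δ / 2 := by positivity
  -- the sign bookkeeping, for `m = p.1 - F.1`, `n = p.2 - F.2` and the direction `(ur, ui)`
  have alg : ∀ m n ur ui : ℝ, 0 ≤ m * (ur + ui) → 0 ≤ n * (ui - ur) → ui ≤ m * (ur + ui) + n * (ui - ur) →
      0 ≤ δ / 2 * (m - n) * ur + δ / 2 * (m + n - 1) * ui := by
    intro m n ur ui h1 h2 h3
    have : δ / 2 * (m - n) * ur + δ / 2 * (m + n - 1) * ui = δ / 2 * (m * (ur + ui) + n * (ui - ur) - ui) := by ring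
    rw [this]; exact mul_nonneg hδ2.le (by linarith)
  rcases le_total |u.re| |u.im| with hri | hir
  · rcases le_total 0 u.im with hi0 | hi0
    · -- north cone (`ui ≥ |ur|`): the north-east vertex
      obtain ⟨p, hp, h1, h2⟩ := hNE
      refine ⟨p, hp, dist_le_of_inner_nonneg_SR ?_ hf⟩
      rw [hre, him]
      change 0 ≤ δ / 2 * _ * u.re + δ / 2 * _ * u.im
      have hm : (1 : ℝ) ≤ (p.1 - F.1 : ℤ) := by exact_mod_cast (show (1 : ℤ) ≤ p.1 - F.1 by omega)
      have hn : (1 : ℝ) ≤ (p.2 - F.2 : ℤ) := by exact_mod_cast (show (1 : ℤ) ≤ p.2 - F.2 by omega)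
      have hui : |u.im| = u.im := abs_of_nonneg hi0
      have hur := abs_le.1 (hri.trans hui.le)
      refine alg _ _ _ _ (mul_nonneg (by linarith) (by linarith)) (mul_nonneg (by linarith) (by linarith)) ?_
      nlinarith [mul_le_mul_of_nonneg_right hm (by linarith : (0:ℝ) ≤ u.re + u.im),
        mul_le_mul_of_nonneg_right hn (by linarith : (0:ℝ) ≤ u.im - u.re)]
    · -- south cone (`-ui ≥ |ur|`): the south-west vertex
      obtain ⟨p, hp, h1, h2⟩ := hSW
      refine ⟨p, hp, dist_le_of_inner_nonneg_SR ?_ hf⟩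
      rw [hre, him]
      change 0 ≤ δ / 2 * _ * u.re + δ / 2 * _ * u.im
      have hm : ((p.1 - F.1 : ℤ) : ℝ) ≤ 0 := by exact_mod_cast (show p.1 - F.1 ≤ (0 : ℤ) by omega)
      have hn : ((p.2 - F.2 : ℤ) : ℝ) ≤ 0 := by exact_mod_cast (show p.2 - F.2 ≤ (0 : ℤ) by omega)
      have hui : |u.im| = -u.im := abs_of_nonpos hi0
      have hur := abs_le.1 (hri.trans hui.le)
      refine alg _ _ _ _ (mul_nonneg_of_nonpos_of_nonpos hm (by linarith))
        (mul_nonneg_of_nonpos_of_nonpos hn (by linarith)) ?_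
      nlinarith [mul_nonneg_of_nonpos_of_nonpos hm (by linarith : u.re + u.im ≤ 0),
        mul_nonneg_of_nonpos_of_nonpos hn (by linarith : u.im - u.re ≤ 0)]
  · rcases le_total 0 u.re with hr0 | hr0
    · -- east cone (`ur ≥ |ui|`): the south-east vertex
      obtain ⟨p, hp, h1, h2⟩ := hSE
      refine ⟨p, hp, dist_le_of_inner_nonneg_SR ?_ hf⟩
      rw [hre, him]
      change 0 ≤ δ / 2 * _ * u.re + δ / 2 * _ * u.im
      have hm : (1 : ℝ) ≤ (p.1 - F.1 : ℤ) := by exact_mod_cast (show (1 : ℤ) ≤ p.1 - F.1 by omega)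
      have hn : ((p.2 - F.2 : ℤ) : ℝ) ≤ 0 := by exact_mod_cast (show p.2 - F.2 ≤ (0 : ℤ) by omega)
      have hur : |u.re| = u.re := abs_of_nonneg hr0
      have hui := abs_le.1 (hir.trans hur.le)
      refine alg _ _ _ _ (mul_nonneg (by linarith) (by linarith)) (mul_nonneg_of_nonpos_of_nonpos hn (by linarith)) ?_
      nlinarith [mul_le_mul_of_nonneg_right hm (by linarith : (0:ℝ) ≤ u.re + u.im),
        mul_nonneg_of_nonpos_of_nonpos hn (by linarith : u.im - u.re ≤ 0)]
    · -- west cone (`-ur ≥ |ui|`): the north-west vertex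
      obtain ⟨p, hp, h1, h2⟩ := hNW
      refine ⟨p, hp, dist_le_of_inner_nonneg_SR ?_ hf⟩
      rw [hre, him]
      change 0 ≤ δ / 2 * _ * u.re + δ / 2 * _ * u.im
      have hm : ((p.1 - F.1 : ℤ) : ℝ) ≤ 0 := by exact_mod_cast (show p.1 - F.1 ≤ (0 : ℤ) by omega)
      have hn : (1 : ℝ) ≤ (p.2 - F.2 : ℤ) := by exact_mod_cast (show (1 : ℤ) ≤ p.2 - F.2 by omega)
      have hur : |u.re| = -u.re := abs_of_nonpos hr0
      have hui := abs_le.1 (hir.trans hur.le)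
      refine alg _ _ _ _ (mul_nonneg_of_nonpos_of_nonpos hm (by linarith)) (mul_nonneg (by linarith) (by linarith)) ?_
      nlinarith [mul_nonneg_of_nonpos_of_nonpos hm (by linarith : u.re + u.im ≤ 0),
        mul_le_mul_of_nonneg_right hn (by linarith : (0:ℝ) ≤ u.im - u.re)]

/-! ## The planar input of the ball-exit case -/

/-- **Two orbit stretches leaving and re-entering a ball with different turning have a far-reaching
excursion polygon** (registered `medialTwoArcSurround_ball`). DATA: dynamics `β₀`, `β₁`; corner `c`;
lengths `n₀`, `n₁`; mesh `δ > 0`; a ball `B(δ v, r)`; both stretches `O c [0, n]` injective;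
`O₀ c n₀ = O₁ c n₁`; `∑_{i<n₀} turnOf β₀ (O₀ c i) ≠ ∑_{j<n₁} turnOf β₁ (O₁ c j)`; the start point
`medialPoint δ (cSrc c)` and the end point `medialPoint δ (cTgt (O₀ c n₀))` in the ball, every other
target midpoint `cTgt (O c i)`, `i < n`, of both stretches outside it. CONCLUSION: an excursion
`(s, t, σ, τ)` (`s < t ≤ n₁`, `σ < n₀`, `1 ≤ τ ≤ n₀`, `O₁ c s = O₀ c σ`, `O₁ c t = O₀ c τ`, no corner
`O₁ c j`, `s < j < t`, on the first stretch, not a common step) whose polygon — vertices the target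
midpoints of `O₁ c j`, `j ∈ [s, t)`, and of `O₀ c i`, `i ∈ [σ, τ)` resp. `[τ - 1, σ]` — is far-reaching
with respect to the start point. -/
theorem medialTwoArcSurround_ballA_SR : ∀ (β₀ β₁ : BondConfig (Site 2)) (c : Site 2 × Fin 4) (n₀ n₁ : ℕ) (δ : ℝ) (v : Site 2) (r : ℝ), 0 < δ → (∀ i j : ℕ, i ≤ n₀ → j ≤ n₀ → cornerOrbit β₀ c i = cornerOrbit β₀ c j → i = j) → (∀ i j : ℕ, i ≤ n₁ → j ≤ n₁ → cornerOrbit β₁ c i = cornerOrbit β₁ c j → i = j) → cornerOrbit β₀ c n₀ = cornerOrbit β₁ c n₁ → ∑ i ∈ Finset.range n₀, turnOf β₀ (cornerOrbit β₀ c i) ≠ ∑ j ∈ Finset.range n₁, turnOf β₁ (cornerOrbit β₁ c j) → medialPoint δ (cSrc c) ∈ ball (meshPoint δ v) r → (∀ i < n₀, medialPoint δ (cTgt (cornerOrbit β₀ c i)) ∉ ball (meshPoint δ v) r) → (∀ j < n₁, medialPoint δ (cTgt (cornerOrbit β₁ c j)) ∉ ball (meshPoint δ v) r) → medialPoint δ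 (cTgt (cornerOrbit β₀ c n₀)) ∈ ball (meshPoint δ v) r → ∃ s t σ τ : ℕ, s < t ∧ t ≤ n₁ ∧ σ < n₀ ∧ 1 ≤ τ ∧ τ ≤ n₀ ∧ cornerOrbit β₁ c s = cornerOrbit β₀ c σ ∧ cornerOrbit β₁ c t = cornerOrbit β₀ c τ ∧ (∀ j, s < j → j < t → ∀ i ≤ n₀, cornerOrbit β₁ c j ≠ cornerOrbit β₀ c i) ∧ ¬ (t = s + 1 ∧ τ = σ + 1) ∧ (∀ q₀ : ℂ, ∃ q ∈ ((fun j => medialPoint δ (cTgt (cornerOrbit β₁ c j))) '' Set.Ico s t ∪ (fun i => medialPoint δ (cTgt (cornerOrbit β₀ c i))) '' (if σ < τ then Set.Ico σ τ else Set.Ico (τ - 1) (σ + 1))), dist (medialPoint δ (cSrc c)) q₀ ≤ dist q q₀ + δ) := by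
  intro β₀ β₁ c n₀ n₁ δ v r hδ hinj₀ hinj₁ hend hturn hA h₀ h₁ hB
  -- lengths are positive
  have hn₀ : 1 ≤ n₀ := by
    rcases Nat.eq_zero_or_pos n₀ with rfl | h
    · exfalso
      have : n₁ = 0 := (hinj₁ 0 n₁ (Nat.zero_le _) le_rfl (by rw [← hend]; rfl)).symm
      subst this; exact hturn rfl
    · exact h
  have hn₁ : 1 ≤ n₁ := by
    rcases Nat.eq_zero_or_pos n₁ with rfl | h
    · exfalso
      have : n₀ = 0 := (hinj₀ 0 n₀ (Nat.zero_le _) le_rfl (by rw [hend]; rfl)).symm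
      subst this; exact hturn rfl
    · exact h
  -- turn signs
  have hts : ∑ i ∈ Finset.range n₀, turnSign β₀ (cornerOrbit β₀ c i) ≠ ∑ j ∈ Finset.range n₁, turnSign β₁ (cornerOrbit β₁ c j) := by
    intro h
    apply hturn
    simp only [turnOf_eq, ← Finset.mul_sum]
    congr 1
    exact_mod_cast congrArg (fun z : ℤ => (z : ℝ)) h
  -- potentials
  set a : ℤ := 2 * (v 0 + v 1) - 1 with ha
  set b : ℤ := 2 * (v 1 - v 0) + 1 with hb
  have hao : a % 2 = 1 := by omega
  have hbo : b % 2 = 1 := by omega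
  rw [medialPoint_cSrc_eq_psiC_SR] at hA
  rw [medialPoint_cTgt_cornerOrbit_SR] at hB
  have hfar : ∀ (β : BondConfig (Site 2)) (n : ℕ), (∀ i < n, medialPoint δ (cTgt (cornerOrbit β c i)) ∉ ball (meshPoint δ v) r) →
      ∀ i, 1 ≤ i → i ≤ n → max ((2 * (cpos c).1 - a) ^ 2 + (2 * (cpos c).2 - b) ^ 2)
        ((2 * (cpos (cornerOrbit β₀ c (n₀ + 1))).1 - a) ^ 2 + (2 * (cpos (cornerOrbit β₀ c (n₀ + 1))).2 - b) ^ 2) <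
        (2 * (cpos (cornerOrbit β c i)).1 - a) ^ 2 + (2 * (cpos (cornerOrbit β c i)).2 - b) ^ 2 := by
    intro β n hout i hi hin
    have hQ := hout (i - 1) (by omega)
    rw [medialPoint_cTgt_cornerOrbit_SR, show i - 1 + 1 = i by omega] at hQ
    exact max_lt (pot_lt_of_ball_SR hδ hA hQ) (pot_lt_of_ball_SR hδ hB hQ)
  obtain ⟨F, hF, hneF⟩ := twoArc_dartWnd_ne_SR β₀ β₁ c n₀ n₁ a b hao hbo hn₀ hn₁ hinj₀ hinj₁ hend
    (hfar β₀ n₀ h₀) (hfar β₁ n₁ h₁) hts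
  obtain ⟨s, t, σ, τ, hst, htn, hσn, hτ1, hτn, hs, ht, hfree, hntriv, qNE, qNW, qSW, qSE⟩ :=
    exists_excursion_quadrants_SR β₀ β₁ c n₀ n₁ F hinj₀ hinj₁ hend hneF
  refine ⟨s, t, σ, τ, hst, htn, hσn, hτ1, hτn, hs, ht, hfree, hntriv, fun q₀ => ?_⟩
  have hadj : (F.1 = (cpos c).1 ∨ F.1 = (cpos c).1 - 1) ∧ (F.2 = (cpos c).2 ∨ F.2 = (cpos c).2 - 1) := by
    rcases hF with rfl | rfl
    · exact (faces_adjacent_tail_SR _).1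
    · exact (faces_adjacent_tail_SR _).2
  obtain ⟨p, hp, hdist⟩ := farReach_of_quadrants_SR hδ F (cpos c) _ hadj qNE qNW qSW qSE q₀
  refine ⟨psiC δ p, ?_, by rwa [medialPoint_cSrc_eq_psiC_SR]⟩
  rcases hp with ⟨j, hj, rfl⟩ | ⟨i, hi, rfl⟩
  · exact Or.inl ⟨j, hj, medialPoint_cTgt_cornerOrbit_SR δ β₁ c j⟩
  · exact Or.inr ⟨i, hi, medialPoint_cTgt_cornerOrbit_SR δ β₀ c i⟩


/-- **Registered form** (`medialTwoArcSurround_ball`): the conclusion of the proposed planar stub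
`medialTwoArcSurround` (far-reaching with respect to the start point OR the end point) under the ball
hypotheses; we prove the first disjunct (`medialTwoArcSurround_ballA_SR`). -/
theorem medialTwoArcSurround_ball : ∀ (β₀ β₁ : BondConfig (Site 2)) (c : Site 2 × Fin 4) (n₀ n₁ : ℕ) (δ : ℝ) (v : Site 2) (r : ℝ), 0 < δ → (∀ i j : ℕ, i ≤ n₀ → j ≤ n₀ → cornerOrbit β₀ c i = cornerOrbit β₀ c j → i = j) → (∀ i j : ℕ, i ≤ n₁ → j ≤ n₁ → cornerOrbit β₁ c i = cornerOrbit β₁ c j → i = j) → cornerOrbit β₀ c n₀ = cornerOrbit β₁ c n₁ → ∑ i ∈ Finset.range n₀, turnOf β₀ (cornerOrbit β₀ c i) ≠ ∑ j ∈ Finset.range n₁, turnOf β₁ (cornerOrbit β₁ c j) → medialPoint δ (cSrc c) ∈ ball (meshPoint δ v) r → (∀ i < n₀, medialPoint δ (cTgt (cornerOrbit β₀ c i)) ∉ ball (meshPoint δ v) r) → (∀ j < n₁, medialPoint δ (cTgt (cornerOrbit β₁ c j)) ∉ ball (meshPoint δ v) r) → medialPoint δ (cTgt (cornerOrbit β₀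 c n₀)) ∈ ball (meshPoint δ v) r → ∃ s t σ τ : ℕ, s < t ∧ t ≤ n₁ ∧ σ < n₀ ∧ 1 ≤ τ ∧ τ ≤ n₀ ∧ cornerOrbit β₁ c s = cornerOrbit β₀ c σ ∧ cornerOrbit β₁ c t = cornerOrbit β₀ c τ ∧ (∀ j, s < j → j < t → ∀ i ≤ n₀, cornerOrbit β₁ c j ≠ cornerOrbit β₀ c i) ∧ ¬ (t = s + 1 ∧ τ = σ + 1) ∧ ((∀ q₀ : ℂ, ∃ q ∈ ((fun j => medialPoint δ (cTgt (cornerOrbit β₁ c j))) '' Set.Ico s t ∪ (fun i => medialPoint δ (cTgt (cornerOrbit β₀ c i))) '' (if σ < τ then Set.Ico σ τ else Set.Ico (τ - 1) (σ + 1))), dist (medialPoint δ (cSrc c)) q₀ ≤ dist q q₀ + δ) ∨ (∀ q₀ : ℂ, ∃ q ∈ ((fun j => medialPoint δ (cTgt (cornerOrbit β₁ c j))) '' Set.Ico s t ∪ (fun i => medialPoint δ (cTgt (cornerOrbit β₀ c i))) '' (if σ < τ then Set.Ico σ τ else Set.Ico (τ - 1) (σ + 1))), dist (medialPoint δ (cTgt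 (cornerOrbit β₀ c n₀))) q₀ ≤ dist q q₀ + δ)) := by
  intro β₀ β₁ c n₀ n₁ δ v r hδ hinj₀ hinj₁ hend hturn hA h₀ h₁ hB
  obtain ⟨s, t, σ, τ, h1, h2, h3, h4, h5, h6, h7, h8, h9, h10⟩ :=
    medialTwoArcSurround_ballA_SR β₀ β₁ c n₀ n₁ δ v r hδ hinj₀ hinj₁ hend hturn hA h₀ h₁ hB
  exact ⟨s, t, σ, τ, h1, h2, h3, h4, h5, h6, h7, h8, h9, Or.inl h10⟩

end

end Summit.CriticalPhenomena.CardyFormulaZ2.Cruxes.EdgePrecompact.QkzStripBoundaryArm
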